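import Literature.RingTheory.FittingIdeal.BaseChange
import Literature.RingTheory.FittingIdeal.Functoriality
import Literature.RingTheory.FittingIdeal.Localization
import Literature.RingTheory.FittingIdeal.DiscreteValuationRing
import Literature.RingTheory.FittingIdeal.Annihilator
import Literature.NumberTheory.EllipticCurves.IwasawaAlgebraCharIdealProofs
import Literature.NumberTheory.EllipticCurves.IwasawaAlgebraStructureProofs
import Mathlib.RingTheory.Filtration
import Mathlib.LinearAlgebra.TensorProduct.Quotient
import Mathlib.RingTheory.Ideal.UFD
import Mathlib.RingTheory.Ideal.Colon
import Mathlib.RingTheory.PowerSeries.Ideal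
import Mathlib.RingTheory.PowerSeries.Inverse
import HarnessLib

/-!
# Fitting ideals under congruences, and principal order ideals versus characteristic ideals
# (the commutative algebra of [Ski16, p. 192] / Castella's erratum p. 4) — cell `b2b-bsdres`, X11b route R1

HONEST FRAMING (cell `b2b-bsdres`, run/shared/lean/b2b/bsd-rank1-residual/, verbatim in every
file): the goal of the cell is to DELETE the COMBINATION-SHAPED residual classes of the
Birch–Swinnerton-Dyer formula for ALL analytic-rank `≤ 1` elliptic curves over `ℚ` — "full BSD
formula for every rank `≤ 1` curve in class `C`" assembled STRICTLY from published theorems — so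
that the rank-`≤ 1` remainder becomes exactly the CONSTRUCTION-SHAPED classes, which are TYPED
(missing-input `Prop`s), NOT attempted. This is not "finishing BSD". Sub-cell
`b2b-bsdres-multr1-p1` (X11b via the re-proof of Castella 2018 Thm. A along the author's erratum):
a RESEARCH ROUTE; no claim beyond the stated class; X11b stays CONSTRUCTION-SHAPED; nothing here
changes a label. THEOREMS ONLY (no definition, no named fact, no `sorry`); pure commutative algebra.

This file is the GENERIC half of `CastellaErratumCongruenceLimit.lean` (which see for the
mathematical context: the erratum's proof of its Thm. 1.1 from its Thm. 2.3 by `p`-adic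
approximation of `f_E` by higher-weight forms and a passage to the limit in Fitting ideals, "the
argument in [Ski16, p. 192] applies verbatim"). Over an arbitrary commutative ring `R`:

1. `fittingIdeal_zero_quotient` — `Fitt₀(R/I) = I` (Stacks 07ZA (1)).
   `fittingIdeal_sup_eq_of_quotEquiv` — "basic properties of Fitting ideals": an `R`-linear
   isomorphism `M/IM ≅ N/IN` of finite modules gives `Fitt_k(M) + I = Fitt_k(N) + I` (Fitting
   ideals commute with the base change `R → R/I`: tree theorem `Module.fittingIdeal_baseChange`,
   Stacks 07ZA (3) / Eisenbud Cor. 20.5).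
2. `iInf_sup_pow_eq_self`, `eq_of_forall_sup_pow_eq` — `R` Noetherian, `I ⊆ Jac(R)`:
   `⋂_m (J + I^m) = J` for every ideal `J` (Krull's intersection theorem, Mathlib's
   `Ideal.iInf_pow_smul_eq_bot_of_le_jacobson`, on `R/J`); ideals congruent modulo every `I^m`
   are equal.
3. `fittingIdeal_sup_pow_eq_of_congruences`, `fittingIdeal_eq_span_of_congruences` — the
   CONGRUENCE LIMIT: if for every `m ≥ 1` there are a finite module `N_m` and `L_m ∈ R` with
   `M/I^mM ≅ N_m/I^mN_m`, `Fitt₀(N_m) = (L_m)` and `(L_m) + I^m = (L) + I^m`, then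
   `Fitt₀(M) + I^m = (L) + I^m` for all `m` ("(Fitt-L-eq)" of [Ski16, p. 192]) and hence
   `Fitt₀(M) = (L)`.
4. `lengthAt_eq_of_fittingIdeal_zero_eq`, `charIdeal_eq_of_fittingIdeal_zero_eq`,
   `charIdeal_quotient_span_singleton`, `isTorsion_of_fittingIdeal_zero_eq_span`,
   `charIdeal_eq_span_of_fittingIdeal_zero_eq_span` — `R` a Noetherian UFD (`𝒪⟦T⟧`, `ℤ_p⟦T⟧`):
   finite modules with the same order ideal have the same local length at every height-one prime
   (`𝔭 = (π)` is principal, `R_𝔭` is a DVR by the tree's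
   `isPrincipalIdealRing_localization_of_eq_span`, Fitting ideals localise —
   `Module.fittingIdeal_of_isLocalizedModule` —, and over a DVR `length(R_𝔭/Fitt₀) = length`,
   `Module.length_quotient_fittingIdeal_zero`), hence the same characteristic ideal
   `charIdeal R M = ∏_{ht 𝔭 = 1} 𝔭^{length(M_𝔭)}`; `char(R/(L)) = (L)`
   (`finprod_heightOne_pow_eq_span_prod`); so `Fitt₀(M) = (L)`, `L ≠ 0` ⟹ `M` torsion and
   `char(M) = (L)` — WITHOUT any hypothesis on finite (pseudo-null) submodules of `M`.

References: C. Skinner, Pacific J. Math. 283 (2016), § 2.3 and § 3.1 (p. 192)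
[Skinner2016PacificMC]; F. Castella, Erratum to CJM 6 (2018), proof of Thm. 1.1 (p. 4)
[Castella2018Erratum]; The Stacks Project, Tag 07ZA [StacksProject]; D. Eisenbud, GTM 150,
Cor. 20.5 [Eisenbud1995]; B. de Smit, K. Rubin, R. Schoof, in *Modular Forms and Fermat's Last
Theorem* (1997), § 1 [DeSmitRubinSchoof1997]; L. Washington, GTM 83, § 13.2 [Washington1997].
-/

noncomputable section

open scoped TensorProduct

open Literature.RingTheory.FittingIdeal Literature.NumberTheory.EllipticCurves
  Literature.NumberTheory.EllipticCurves.Module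

namespace Summit.BirchSwinnertonDyer.Rank1Residual.X11b.CongruenceLimit

universe u

variable {R : Type u} [CommRing R]

/-! ### 1. "Basic properties of Fitting ideals": reduction modulo an ideal -/

/-- **The order ideal of a cyclic module**: `Fitt₀(R/I) = I` (Stacks 07ZA (1); the tree has the
inclusion `I ⊆ Fitt₀(R/I)` as `Module.mem_fittingIdeal_zero_quotient`, the other inclusion is
`Fitt₀ ⊆ Ann`). [cite: StacksProject, Tag 07ZA] -/
theorem fittingIdeal_zero_quotient (I : Ideal R) : Module.fittingIdeal R (R ⧸ I) 0 = I := by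
  refine le_antisymm ?_ fun i hi => Module.mem_fittingIdeal_zero_quotient I hi
  calc Module.fittingIdeal R (R ⧸ I) 0 ≤ Module.annihilator R (R ⧸ I) :=
      Module.fittingIdeal_zero_le_annihilator
    _ = I := Ideal.annihilator_quotient

/-- **"Basic properties of Fitting ideals"** (the step of [Ski16, p. 192] / erratum p. 4): if the
finite `R`-modules `M`, `N` become isomorphic modulo an ideal `I` — an `R`-linear isomorphism
`M/IM ≅ N/IN` — then `Fitt_k(M) + I = Fitt_k(N) + I` for every `k`. Proof: Fitting ideals commute
with the base change `R → R/I` (`Module.fittingIdeal_baseChange`, Stacks 07ZA (3)),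
`(R/I) ⊗_R M ≅ M/IM` (Mathlib `TensorProduct.quotTensorEquivQuotSMul`), an `R`-linear isomorphism
of `R/I`-modules is `R/I`-linear, and `π⁻¹(π(J)) = J + I` for `π : R → R/I`.
[cite: Skinner2016PacificMC, §3.1 (p. 192), "From basic properties of Fitting ideals"]
[cite: StacksProject, Tag 07ZA (3)] -/
theorem fittingIdeal_sup_eq_of_quotEquiv (I : Ideal R) {M N : Type*} [AddCommGroup M]
    [Module R M] [AddCommGroup N] [Module R N] [Module.Finite R M] [Module.Finite R N]
    (e : (M ⧸ (I • (⊤ : Submodule R M))) ≃ₗ[R] (N ⧸ (I • (⊤ : Submodule R N)))) (k : ℕ) :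
    Module.fittingIdeal R M k ⊔ I = Module.fittingIdeal R N k ⊔ I := by
  have hsurj : Function.Surjective (algebraMap R (R ⧸ I)) := Ideal.Quotient.mk_surjective
  -- the `R/I`-linear isomorphism `(R/I) ⊗ M ≃ (R/I) ⊗ N`
  let f : ((R ⧸ I) ⊗[R] M) ≃ₗ[R] ((R ⧸ I) ⊗[R] N) :=
    TensorProduct.quotTensorEquivQuotSMul M I ≪≫ₗ e ≪≫ₗ
      (TensorProduct.quotTensorEquivQuotSMul N I).symm
  let f' : ((R ⧸ I) ⊗[R] M) ≃ₗ[R ⧸ I] ((R ⧸ I) ⊗[R] N) := f.extendScalarsOfSurjective hsurj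
  have h1 : Module.fittingIdeal (R ⧸ I) ((R ⧸ I) ⊗[R] M) k =
      Module.fittingIdeal (R ⧸ I) ((R ⧸ I) ⊗[R] N) k :=
    Module.fittingIdeal_eq_of_linearEquiv f' k
  rw [Module.fittingIdeal_baseChange, Module.fittingIdeal_baseChange] at h1
  have h2 := congrArg (Ideal.comap (algebraMap R (R ⧸ I))) h1
  rw [Ideal.comap_map_of_surjective _ hsurj, Ideal.comap_map_of_surjective _ hsurj,
    ← RingHom.ker_eq_comap_bot, Ideal.Quotient.algebraMap_eq, Ideal.mk_ker] at h2
  exact h2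

/-! ### 2. Krull's intersection theorem in the form `⋂ₘ (J + I^m) = J` -/

/-- **Ideals of a Noetherian ring are closed for the `I`-adic topology, `I ⊆ Jac(R)`**:
`⋂_m (J + I^m) = J` for every ideal `J` — Krull's intersection theorem
(`Ideal.iInf_pow_smul_eq_bot_of_le_jacobson`) for the finite module `R/J`, pulled back along
`R → R/J`. This is the step by which the kernel proof passes from "`(J, p^m) = (J′, p^m)` for all
`m`" to `J = J′`, in place of the `p`-adic convergence argument of [Ski16, p. 192]. [folklore] -/
theorem iInf_sup_pow_eq_self [IsNoetherianRing R] (I J : Ideal R)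
    (hI : I ≤ (⊥ : Ideal R).jacobson) : ⨅ m : ℕ, J ⊔ I ^ m = J := by
  have hK : (⨅ m : ℕ, I ^ m • (⊤ : Submodule R (R ⧸ J))) = ⊥ :=
    Ideal.iInf_pow_smul_eq_bot_of_le_jacobson I hI
  have hm : ∀ m : ℕ,
      J ⊔ I ^ m = Submodule.comap J.mkQ (I ^ m • (⊤ : Submodule R (R ⧸ J))) := by
    intro m
    rw [← Submodule.range_mkQ J, ← Submodule.map_top, ← Submodule.map_smul'',
      Submodule.comap_map_mkQ, Ideal.smul_eq_mul, Ideal.mul_top]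
  calc ⨅ m : ℕ, J ⊔ I ^ m
      = ⨅ m : ℕ, Submodule.comap J.mkQ (I ^ m • (⊤ : Submodule R (R ⧸ J))) := iInf_congr hm
    _ = Submodule.comap J.mkQ (⨅ m : ℕ, I ^ m • (⊤ : Submodule R (R ⧸ J))) :=
        (Submodule.comap_iInf _ _).symm
    _ = J := by rw [hK, Submodule.comap_bot, Submodule.ker_mkQ]

/-- Two ideals congruent modulo every power of an ideal `I ⊆ Jac(R)` of a Noetherian ring are
equal. [folklore] -/
theorem eq_of_forall_sup_pow_eq [IsNoetherianRing R] {I : Ideal R} (hI : I ≤ (⊥ : Ideal R).jacobson)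
    {J J' : Ideal R} (h : ∀ m : ℕ, 1 ≤ m → J ⊔ I ^ m = J' ⊔ I ^ m) : J = J' := by
  rw [← iInf_sup_pow_eq_self I J hI, ← iInf_sup_pow_eq_self I J' hI]
  refine iInf_congr fun m => ?_
  rcases Nat.eq_zero_or_pos m with rfl | hm
  · rw [pow_zero, Ideal.one_eq_top, sup_top_eq, sup_top_eq]
  · exact h m hm

/-! ### 3. The congruence limit for Fitting ideals (erratum p. 4, display; [Ski16] (Fitt-L-eq)) -/

section Congruences

variable [IsNoetherianRing R] (I : Ideal R)
  {M : Type*} [AddCommGroup M] [Module R M] [Module.Finite R M] (L : R)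
  (N : ℕ → Type*) [∀ m, AddCommGroup (N m)] [∀ m, Module R (N m)] [∀ m, Module.Finite R (N m)]
  (Lm : ℕ → R)

omit [IsNoetherianRing R] in
/-- **(Fitt-L-eq)** — erratum p. 4: "from (b), Lemma 2.1, and basic properties of Fitting ideals
we deduce the equality `(Fitt(X^Σ_ac(E[p^∞])), p^m) = (L^Σ_p(f), p^m)`"; [Ski16, p. 192]:
"`(F^Σ(f), p^m) = (F^Σ(f_m), p^m)` … Together with (c), (e), and (f) we then have
`(F^Σ(f), p^m) = (𝓛^Σ_f, p^m)`". Abstractly: for each `m ≥ 1` an `R`-linear isomorphism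
`M/I^mM ≅ N_m/I^mN_m` (`e`; = (b)∘Lemma 2.1, dualised), `Fitt₀(N_m) = (L_m)` (`hF`; = Thm. 2.3
for `g_m` ∘ Lemma 2.2) and `(L_m) + I^m = (L) + I^m` (`hc`; = (c)) give
`Fitt₀(M) + I^m = (L) + I^m`. [cite: Castella2018Erratum, proof of Thm. 1.1 (p. 4), display]
[cite: Skinner2016PacificMC, §3.1 (p. 192), (Fitt-L-eq)] -/
theorem fittingIdeal_sup_pow_eq_of_congruences
    (e : ∀ m : ℕ, 1 ≤ m →
      ((M ⧸ (I ^ m • (⊤ : Submodule R M))) ≃ₗ[R] (N m ⧸ (I ^ m • (⊤ : Submodule R (N m))))))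
    (hF : ∀ m : ℕ, 1 ≤ m → Module.fittingIdeal R (N m) 0 = Ideal.span {Lm m})
    (hc : ∀ m : ℕ, 1 ≤ m → Ideal.span {Lm m} ⊔ I ^ m = Ideal.span {L} ⊔ I ^ m)
    (m : ℕ) (hm : 1 ≤ m) :
    Module.fittingIdeal R M 0 ⊔ I ^ m = Ideal.span {L} ⊔ I ^ m := by
  rw [fittingIdeal_sup_eq_of_quotEquiv (I ^ m) (e m hm) 0, hF m hm, hc m hm]

/-- **The congruence limit** (the conclusion "`F^Σ(f) = (𝓛^Σ_f)`" of [Ski16, p. 192] / erratum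
p. 4, here WITHOUT the hypothesis "`Ch = Fitt` for `M`" and by Krull's intersection theorem instead
of `p`-adic convergence): under the hypotheses of `fittingIdeal_sup_pow_eq_of_congruences` and
`I ⊆ Jac(R)` (`I = (p)` in the local ring `Λ_𝒪`), `Fitt₀(M) = (L)`.
[cite: Castella2018Erratum, proof of Thm. 1.1 (p. 4)] [cite: Skinner2016PacificMC, §3.1 (p. 192)] -/
theorem fittingIdeal_eq_span_of_congruences (hI : I ≤ (⊥ : Ideal R).jacobson)
    (e : ∀ m : ℕ, 1 ≤ m →
      ((M ⧸ (I ^ m • (⊤ : Submodule R M))) ≃ₗ[R] (N m ⧸ (I ^ m • (⊤ : Submodule R (N m))))))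
    (hF : ∀ m : ℕ, 1 ≤ m → Module.fittingIdeal R (N m) 0 = Ideal.span {Lm m})
    (hc : ∀ m : ℕ, 1 ≤ m → Ideal.span {Lm m} ⊔ I ^ m = Ideal.span {L} ⊔ I ^ m) :
    Module.fittingIdeal R M 0 = Ideal.span {L} :=
  eq_of_forall_sup_pow_eq hI (fittingIdeal_sup_pow_eq_of_congruences I L N Lm e hF hc)

end Congruences

/-! ### 4. From a principal order ideal to the characteristic ideal (Noetherian UFD) -/

section CharIdeal

variable {M N : Type*} [AddCommGroup M] [Module R M] [AddCommGroup N] [Module R N]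

/-- A module whose order ideal contains a nonzero element of a domain is torsion
(`Fitt₀ ⊆ Ann`). [folklore] -/
theorem isTorsion_of_fittingIdeal_zero_eq_span [IsDomain R] {L : R}
    (h : Module.fittingIdeal R M 0 = Ideal.span {L}) (hL : L ≠ 0) : Module.IsTorsion R M := by
  intro x
  refine ⟨⟨L, mem_nonZeroDivisors_of_ne_zero hL⟩, ?_⟩
  have hmem : L ∈ Module.annihilator R M :=
    Module.fittingIdeal_zero_le_annihilator (h ▸ Ideal.mem_span_singleton_self L)
  exact Module.mem_annihilator.mp hmem x

/-- **Equal order ideals give equal local lengths at a nonzero principal prime** of a Noetherian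
domain: `R_𝔭` is then a discrete valuation ring (`isPrincipalIdealRing_localization_of_eq_span`),
Fitting ideals localise (`Module.fittingIdeal_of_isLocalizedModule`), and over a DVR the length
of a finite module is the colength of its order ideal (`Module.length_quotient_fittingIdeal_zero`,
de Smit–Rubin–Schoof). [folklore] -/
theorem lengthAt_eq_of_fittingIdeal_zero_eq [IsNoetherianRing R] [IsDomain R]
    [Module.Finite R M] [Module.Finite R N]
    (h : Module.fittingIdeal R M 0 = Module.fittingIdeal R N 0)
    (𝔭 : PrimeSpectrum R) {g : R} (hg𝔭 : 𝔭.asIdeal = Ideal.span {g}) (hg : g ≠ 0) :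
    lengthAt R M 𝔭 = lengthAt R N 𝔭 := by
  obtain ⟨hPID, hmax, hirr⟩ := isPrincipalIdealRing_localization_of_eq_span 𝔭.asIdeal hg𝔭 hg
  haveI : IsPrincipalIdealRing (Localization.AtPrime 𝔭.asIdeal) := hPID
  haveI : IsDiscreteValuationRing (Localization.AtPrime 𝔭.asIdeal) :=
    { not_a_field' := by
        rw [hmax, Ne, Ideal.span_singleton_eq_bot]
        exact hirr.ne_zero }
  have hF : Module.fittingIdeal (Localization.AtPrime 𝔭.asIdeal)
        (LocalizedModule 𝔭.asIdeal.primeCompl M) 0 =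
      Module.fittingIdeal (Localization.AtPrime 𝔭.asIdeal)
        (LocalizedModule 𝔭.asIdeal.primeCompl N) 0 := by
    rw [Module.fittingIdeal_of_isLocalizedModule 𝔭.asIdeal.primeCompl
        (Localization.AtPrime 𝔭.asIdeal) (LocalizedModule.mkLinearMap 𝔭.asIdeal.primeCompl M) 0,
      Module.fittingIdeal_of_isLocalizedModule 𝔭.asIdeal.primeCompl
        (Localization.AtPrime 𝔭.asIdeal) (LocalizedModule.mkLinearMap 𝔭.asIdeal.primeCompl N) 0,
      h]
  unfold lengthAt
  rw [← Module.length_quotient_fittingIdeal_zero (O := Localization.AtPrime 𝔭.asIdeal)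
      (N := LocalizedModule 𝔭.asIdeal.primeCompl M),
    ← Module.length_quotient_fittingIdeal_zero (O := Localization.AtPrime 𝔭.asIdeal)
      (N := LocalizedModule 𝔭.asIdeal.primeCompl N), hF]

/-- **Equal order ideals give equal characteristic ideals** over a Noetherian UFD: every
height-one prime is principal and nonzero (`UniqueFactorizationMonoid.isPrincipal_of_height_eq_one`),
so the local lengths agree by `lengthAt_eq_of_fittingIdeal_zero_eq`. [folklore] -/
theorem charIdeal_eq_of_fittingIdeal_zero_eq [IsNoetherianRing R] [IsDomain R]
    [UniqueFactorizationMonoid R] [Module.Finite R M] [Module.Finite R N]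
    (h : Module.fittingIdeal R M 0 = Module.fittingIdeal R N 0) :
    charIdeal R M = charIdeal R N := by
  unfold charIdeal
  refine finprod_mem_congr rfl fun 𝔭 h𝔭 => ?_
  have h1 : 𝔭.asIdeal.height = 1 := h𝔭
  obtain ⟨g, hg⟩ := UniqueFactorizationMonoid.isPrincipal_of_height_eq_one h1
  have hg' : 𝔭.asIdeal = Ideal.span {g} := by rw [hg, Ideal.submodule_span_eq]
  have hg0 : g ≠ 0 := by
    rintro rfl
    exact Ideal.ne_bot_of_height_eq_one h1 (by rw [hg', Ideal.span_singleton_eq_bot])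
  rw [lengthAt_eq_of_fittingIdeal_zero_eq h 𝔭 hg' hg0]

open scoped Classical in
/-- **The characteristic ideal of a nonzero cyclic module `R/(L)` of a Noetherian UFD is `(L)`**:
factor `L` into primes `π₁ ⋯ π_r`; the local length of `R/(π₁ ⋯ π_r)` at a height-one prime `𝔭`
is the number of `πᵢ ∈ 𝔭` (`lengthAt_quotient_span_singleton_multisetProd`,
`lengthAt_quotient_span_singleton`), and `∏_{ht 𝔭 = 1} 𝔭^{#{i | πᵢ ∈ 𝔭}} = (π₁ ⋯ π_r)`
(`finprod_heightOne_pow_eq_span_prod`). [cite: Washington1997, §13.2] -/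
theorem charIdeal_quotient_span_singleton [IsNoetherianRing R] [IsDomain R]
    [UniqueFactorizationMonoid R] {L : R} (hL : L ≠ 0) :
    charIdeal R (R ⧸ Ideal.span {L}) = Ideal.span {L} := by
  classical
  set s : Multiset R := UniqueFactorizationMonoid.factors L with hs
  have hprime : ∀ π ∈ s, Prime π := fun π hπ => UniqueFactorizationMonoid.prime_of_factor π hπ
  have hassoc : Associated s.prod L := UniqueFactorizationMonoid.factors_prod hL
  have hspan : Ideal.span {L} = Ideal.span {s.prod} :=
    (Ideal.span_singleton_eq_span_singleton.mpr hassoc).symm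
  -- replace `R/(L)` by `R/(∏ s)`
  have hlen : ∀ 𝔭 : PrimeSpectrum R, lengthAt R (R ⧸ Ideal.span {L}) 𝔭 =
      lengthAt R (R ⧸ Ideal.span {s.prod}) 𝔭 := fun 𝔭 =>
    lengthAt_eq_of_linearEquiv (Submodule.quotEquivOfEq _ _ hspan) 𝔭
  conv_rhs => rw [hspan, ← finprod_heightOne_pow_eq_span_prod s hprime]
  unfold charIdeal
  refine finprod_mem_congr rfl fun 𝔭 h𝔭 => ?_
  have h1 : 𝔭.asIdeal.height = 1 := h𝔭
  congr 1
  rw [hlen 𝔭, lengthAt_quotient_span_singleton_multisetProd s (fun a ha => (hprime a ha).ne_zero) 𝔭]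
  have hmap : (s.map fun a => lengthAt R (R ⧸ Ideal.span {a}) 𝔭) =
      (s.map fun π => ((if π ∈ 𝔭.asIdeal then 1 else 0 : ℕ) : ℕ∞)) := by
    refine Multiset.map_congr rfl fun π hπ => ?_
    rw [lengthAt_quotient_span_singleton (hprime π hπ) 𝔭 h1]
    split_ifs <;> simp
  have hcast : (s.map fun π => ((if π ∈ 𝔭.asIdeal then 1 else 0 : ℕ) : ℕ∞)) =
      (s.map fun π => (if π ∈ 𝔭.asIdeal then 1 else 0 : ℕ)).map (fun n : ℕ => (n : ℕ∞)) := by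
    rw [Multiset.map_map]; rfl
  rw [hmap, hcast, ← Nat.cast_multiset_sum, ENat.toNat_coe]

/-- **A principal nonzero order ideal is the characteristic ideal** (Noetherian UFD, e.g.
`Λ_𝒪 = 𝒪⟦T⟧`): if `Fitt₀(M) = (L)` with `L ≠ 0` then `char(M) = (L)`. No hypothesis on finite
submodules of `M` is needed (they are invisible at height-one primes; the hypothesis that `Fitt₀`
be principal is what carries the content). With `isTorsion_of_fittingIdeal_zero_eq_span` this is
the passage "`F^Σ(f) = (𝓛^Σ_f)` ⟹ `X^Σ(f)` torsion and `Ch^Σ(f) = (𝓛^Σ_f)`".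
[cite: Skinner2016PacificMC, §3.1 (p. 192)] [cite: Washington1997, §13.2] -/
theorem charIdeal_eq_span_of_fittingIdeal_zero_eq_span [IsNoetherianRing R] [IsDomain R]
    [UniqueFactorizationMonoid R] [Module.Finite R M] {L : R}
    (h : Module.fittingIdeal R M 0 = Ideal.span {L}) (hL : L ≠ 0) :
    charIdeal R M = Ideal.span {L} := by
  rw [charIdeal_eq_of_fittingIdeal_zero_eq (N := R ⧸ Ideal.span {L})
      (h.trans (fittingIdeal_zero_quotient (Ideal.span {L})).symm),
    charIdeal_quotient_span_singleton hL]

end CharIdeal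

end Summit.BirchSwinnertonDyer.Rank1Residual.X11b.CongruenceLimit

end
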